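import Summits.AtomisticToContinuum.HydrodynamicLimit.Theorems.BoltzmannGreenKubo.Negative.ForallN
import Summits.AtomisticToContinuum.HydrodynamicLimit.Theorems.BoltzmannGreenKubo.Negative.PiStatics
import Summits.AtomisticToContinuum.HydrodynamicLimit.Theorems.BoltzmannGreenKubo.Negative.TimeAverage
import Summits.AtomisticToContinuum.HydrodynamicLimit.Theorems.BoltzmannGreenKubo.Negative.MomentumWitness
import Literature.Analysis.FluidPDE.HardSphereAlexander

/-!
# Free-streaming dephasing of modulated one-body observables along hard-sphere trajectories

Negative-knowledge infrastructure for the crux `AntiMazurCoboundaries.BoltzmannGreenKubo` (stmt-AtomisticToContinuum-13985),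
from the standing disprover's `Cruxes/BoltzmannGreenKubo/Disproof.lean` §2c (gen 2); consumed by `Negative/UniformPhi.lean`
(`not_boltzmannGreenKuboUniformPhi`). Deterministic part: for the modulations `φ_k(x) = cos(2πk x₀)` on `𝕋³`
(`cosK`, `∫_{𝕋³} φ_k² = 1/2`) and any bounded continuous `g`, the window integral `∫ₐᵇ Σᵢ φ_k(xᵢ(r)) g(vᵢ(r)) dr` along a
hard-sphere trajectory on the torus tends to `0` as `k → ∞` (`tendsto_integral_obsK`), provided no particle ever has a
vanishing first velocity component: along one free flight `|∫ cos(2πk(y + (r−a)v)) dr| ≤ 1/(πk|v|)`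
(`abs_integral_cos_flight_le`, Riemann–Lebesgue by hand), and a window splits at the finitely many collision times strictly
inside it (`IsHardSphereTrajectory.locFinite`; induction on their number).
refuter-cdisprove-stmt-AtomisticToContinuum-13985-g2-0.
-/

noncomputable section

namespace Summit.AtomisticToContinuum.HydrodynamicLimit.Theorems

open MeasureTheory ProbabilityTheory Filter Topology Set
open Literature.Analysis.FluidPDE Literature.MathematicalPhysics.KineticTheory
open Literature.Analysis.UnboundedOperators
open scoped InnerProductSpace
open BoltzmannGreenKuboForallN BoltzmannGreenKuboOrthMomentum

namespace BoltzmannGreenKuboUniformPhi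

/-! ### The oscillating modulations `cos(2πk x₀)` on the unit circle / torus -/

/-- `y ↦ cos(2πky)` is `1`-periodic for `k : ℕ`. [folklore] -/
theorem periodic_cosK (k : ℕ) : Function.Periodic (fun y : ℝ => Real.cos (2 * Real.pi * k * y)) 1 := by
  intro y
  simp only
  rw [mul_add, mul_one, show 2 * Real.pi * (k : ℝ) = (k : ℝ) * (2 * Real.pi) by ring,
    Real.cos_add_nat_mul_two_pi]

/-- The modulation `cos(2πk ·)` on the unit circle. [folklore] -/
def cosK (k : ℕ) : UnitAddCircle → ℝ := (periodic_cosK k).lift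

/-- Value of the modulation on a real lift. [folklore] -/
theorem cosK_coe (k : ℕ) (y : ℝ) : cosK k (y : UnitAddCircle) = Real.cos (2 * Real.pi * k * y) :=
  (periodic_cosK k).lift_coe y

/-- The modulation is continuous on the circle (quotient topology). [folklore] -/
theorem continuous_cosK (k : ℕ) : Continuous (cosK k) :=
  continuous_coinduced_dom.mpr (by
    show Continuous fun y : ℝ => cosK k (y : UnitAddCircle)
    simp only [cosK_coe]
    fun_prop)

/-- The modulation is bounded by `1`. [folklore] -/
theorem abs_cosK_le (k : ℕ) (x : UnitAddCircle) : |cosK k x| ≤ 1 := by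
  induction x using QuotientAddGroup.induction_on with
  | H y => rw [cosK_coe]; exact Real.abs_cos_le_one _

/-- `∫₀¹ cos²(2πky) dy = 1/2` for `k ≥ 1`. [folklore] -/
theorem integral_cos_sq_unit (k : ℕ) (hk : 1 ≤ k) :
    ∫ y in (0 : ℝ)..1, Real.cos (2 * Real.pi * k * y) ^ 2 = 1 / 2 := by
  have hc : (2 * Real.pi * k : ℝ) ≠ 0 := by positivity
  have h1 := intervalIntegral.integral_comp_mul_left (fun x => Real.cos x ^ 2) hc (a := 0) (b := 1)
  rw [h1, integral_cos_sq]
  have hs : Real.sin (2 * Real.pi * k) = 0 := by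
    rw [show 2 * Real.pi * (k : ℝ) = ((2 * k : ℕ) : ℝ) * Real.pi by push_cast; ring]
    exact Real.sin_nat_mul_pi _
  simp only [mul_zero, Real.sin_zero, mul_one, hs, sub_zero, smul_eq_mul, zero_add]
  field_simp

/-- `∫_{𝕋¹} cosK² = 1/2`. [folklore] -/
theorem integral_cosK_sq_circle (k : ℕ) (hk : 1 ≤ k) :
    ∫ t : UnitAddCircle, cosK k t ^ 2 = 1 / 2 := by
  rw [← UnitAddCircle.intervalIntegral_preimage 0 (fun t => cosK k t ^ 2)]
  simp only [cosK_coe, zero_add]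
  exact integral_cos_sq_unit k hk

/-- `∫_{𝕋³} cos²(2πk x₀) dx = 1/2`. [folklore] -/
theorem integral_cosK_sq_torus (k : ℕ) (hk : 1 ≤ k) :
    ∫ x : T3, cosK k (x 0) ^ 2 = 1 / 2 := by
  have hmp : MeasurePreserving (fun x : T3 => x 0) volume volume := by
    have := MeasureTheory.measurePreserving_eval (μ := fun _ : Fin 3 => (volume : Measure UnitAddCircle)) 0
    simpa [MeasureTheory.volume_pi] using this
  have h := integral_map (μ := (volume : Measure T3)) (φ := fun x : T3 => x 0)
    hmp.measurable.aemeasurable (f := fun t : UnitAddCircle => cosK k t ^ 2)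
    (((continuous_cosK k).pow 2).aestronglyMeasurable)
  rw [hmp.map_eq] at h
  rw [← h]
  exact integral_cosK_sq_circle k hk

/-! ### Riemann–Lebesgue along one free flight, by hand -/

/-- `|∫ₐᵇ cos(2πk(y + (r − a)v)) dr| ≤ 1/(πk|v|)` for `v ≠ 0`, `k ≥ 1`. [folklore] -/
theorem abs_integral_cos_flight_le {a b y v : ℝ} (hv : v ≠ 0) {k : ℕ} (hk : 1 ≤ k) :
    |∫ r in a..b, Real.cos (2 * Real.pi * k * (y + (r - a) * v))| ≤ 1 / (Real.pi * k * |v|) := by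
  have hkpos : (0 : ℝ) < k := by exact_mod_cast hk
  have hc : (2 * Real.pi * k * v : ℝ) ≠ 0 := by positivity
  have hrw : (fun r : ℝ => Real.cos (2 * Real.pi * k * (y + (r - a) * v))) =
      fun r => Real.cos ((2 * Real.pi * k * v) * r + 2 * Real.pi * k * (y - a * v)) := by
    funext r; congr 1; ring
  rw [hrw, intervalIntegral.integral_comp_mul_add (fun x => Real.cos x) hc, integral_cos, smul_eq_mul,
    abs_mul, abs_inv]
  have hsin : |Real.sin (2 * Real.pi * ↑k * v * b + 2 * Real.pi * ↑k * (y - a * v)) -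
      Real.sin (2 * Real.pi * ↑k * v * a + 2 * Real.pi * ↑k * (y - a * v))| ≤ 2 := by
    refine (abs_sub _ _).trans ?_
    have := Real.abs_sin_le_one (2 * Real.pi * ↑k * v * b + 2 * Real.pi * ↑k * (y - a * v))
    have := Real.abs_sin_le_one (2 * Real.pi * ↑k * v * a + 2 * Real.pi * ↑k * (y - a * v))
    linarith
  have habs : |2 * Real.pi * ↑k * v| = 2 * Real.pi * k * |v| := by
    rw [abs_mul, abs_of_pos (by positivity : (0:ℝ) < 2 * Real.pi * k)]
  rw [habs]
  calc (2 * Real.pi * ↑k * |v|)⁻¹ * |Real.sin (2 * Real.pi * ↑k * v * b + 2 * Real.pi * ↑k * (y - a * v)) -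
        Real.sin (2 * Real.pi * ↑k * v * a + 2 * Real.pi * ↑k * (y - a * v))|
      ≤ (2 * Real.pi * ↑k * |v|)⁻¹ * 2 :=
        mul_le_mul_of_nonneg_left hsin (inv_nonneg.2 (by positivity))
    _ = 1 / (Real.pi * k * |v|) := by
        have : 0 < |v| := abs_pos.2 hv
        field_simp

/-- The free-flight cosine integral tends to `0` as `k → ∞` (uniformly in the phase). [folklore] -/
theorem tendsto_integral_cos_flight {a b v : ℝ} (hv : v ≠ 0) (y : ℕ → ℝ) :
    Tendsto (fun k : ℕ => ∫ r in a..b, Real.cos (2 * Real.pi * k * (y k + (r - a) * v))) atTop (𝓝 0) := by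
  have hlim : Tendsto (fun k : ℕ => 1 / (Real.pi * |v|) * (1 / (k : ℝ))) atTop (𝓝 0) := by
    have h1 : Tendsto (fun k : ℕ => 1 / (k : ℝ)) atTop (𝓝 0) := tendsto_one_div_atTop_nhds_zero_nat
    simpa using h1.const_mul (1 / (Real.pi * |v|))
  refine squeeze_zero_norm' ?_ hlim
  filter_upwards [eventually_ge_atTop 1] with k hk
  rw [Real.norm_eq_abs]
  refine (abs_integral_cos_flight_le hv hk).trans_eq ?_
  have : 0 < |v| := abs_pos.2 hv
  have hkpos : (0 : ℝ) < k := by exact_mod_cast hk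
  field_simp

/-! ### The modulated one-body observable and its free-flight pieces -/

variable {n : ℕ}

/-- The modulated one-body observable `w ↦ Σᵢ cos(2πk xᵢ₀) g(vᵢ)`. [folklore] -/
def obsK (k : ℕ) (g : V3 → ℝ) (w : Config n (Fin 3) T3) : ℝ := ∑ i, cosK k ((w i).1 0) * g ((w i).2)

/-- The modulated observable is continuous on phase space. [folklore] -/
theorem continuous_obsK (k : ℕ) {g : V3 → ℝ} (hg : Continuous g) : Continuous (obsK (n := n) k g) := by
  unfold obsK
  refine continuous_finsetSum _ fun i _ => ?_
  exact ((continuous_cosK k).comp ((continuous_apply 0).comp (continuous_apply i).fst)).mul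
    (hg.comp (continuous_apply i).snd)

/-- The modulated observable is bounded by `n·K`. [folklore] -/
theorem abs_obsK_le (k : ℕ) {g : V3 → ℝ} {K : ℝ} (hgb : ∀ v, |g v| ≤ K) (w : Config n (Fin 3) T3) :
    |obsK k g w| ≤ n * K := by
  unfold obsK
  refine (Finset.abs_sum_le_sum_abs _ _).trans ?_
  calc ∑ i, |cosK k ((w i).1 0) * g ((w i).2)| ≤ ∑ _i : Fin n, K := Finset.sum_le_sum fun i _ => by
          rw [abs_mul]
          have h1 := abs_cosK_le k ((w i).1 0)
          have h2 := hgb (w i).2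
          have h3 : 0 ≤ |g (w i).2| := abs_nonneg _
          nlinarith
    _ = n * K := by simp [Finset.sum_const, Finset.card_univ, Fintype.card_fin]

/-- A real lift of the first coordinate of a torus point. [folklore] -/
theorem coe_reprSym_zero (x : T3) : (((Torus.reprSym x 0 : ℝ)) : UnitAddCircle) = x 0 := by
  have := congrFun (Torus.proj_reprSym x) 0
  simpa [Literature.Analysis.FunctionSpaces.Torus.proj_apply] using this

/-- The observable along a free flight on the torus is an explicit trigonometric sum. [folklore] -/
theorem obsK_freeFlight (k : ℕ) (g : V3 → ℝ) (t : ℝ) (w : Config n (Fin 3) T3) :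
    obsK k g (freeFlight (Torus.geometry (Fin 3)) t w) =
      ∑ i, Real.cos (2 * Real.pi * k * (Torus.reprSym (w i).1 0 + t * (w i).2 0)) * g (w i).2 := by
  unfold obsK
  refine Finset.sum_congr rfl fun i _ => ?_
  simp only [freeFlight_apply, Torus.geometry_translate, Pi.add_apply,
    Literature.Analysis.FunctionSpaces.Torus.proj_smul_apply]
  rw [← coe_reprSym_zero (w i).1, ← AddCircle.coe_add, cosK_coe]

/-- Bounded measurable functions are interval integrable. [folklore] -/
theorem intervalIntegrable_of_bounded {f : ℝ → ℝ} (hf : Measurable f) {M : ℝ} (hb : ∀ r, |f r| ≤ M)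
    (a b : ℝ) : IntervalIntegrable f volume a b := by
  rw [intervalIntegrable_iff]
  refine Measure.integrableOn_of_bounded ?_ hf.aestronglyMeasurable (M := M)
    (Eventually.of_forall fun r => by rw [Real.norm_eq_abs]; exact hb r)
  exact ((measure_mono Set.uIoc_subset_uIcc).trans_lt isCompact_uIcc.measure_lt_top).ne

/-- **Free piece.** On a stretch `[a, b]` with no collision strictly inside, the window integral of the modulated
observable along a hard-sphere trajectory is the explicit free-flight trigonometric integral. [folklore] -/
theorem integral_piece_eq {ε : ℝ} {γ : ℝ → Config n (Fin 3) T3}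
    (hγ : IsHardSphereTrajectory (Torus.geometry (Fin 3)) ε n γ) {a b : ℝ} (hab : a ≤ b)
    (hfree : ∀ τ ∈ Ioo a b, τ ∉ collisionTimes (Torus.geometry (Fin 3)) ε γ) (k : ℕ) (g : V3 → ℝ) :
    ∫ r in a..b, obsK k g (γ r) =
      ∫ r in a..b, ∑ i, Real.cos (2 * Real.pi * k * (Torus.reprSym (γ a i).1 0 + (r - a) * (γ a i).2 0)) *
        g (γ a i).2 := by
  refine intervalIntegral.integral_congr_ae ?_
  have hne : ∀ᵐ r ∂(volume : Measure ℝ), r ≠ b := by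
    have : (volume : Measure ℝ) {r | ¬ r ≠ b} = 0 := by
      simp only [ne_eq, not_not, Set.setOf_eq_eq_singleton, Real.volume_singleton]
    exact ae_iff.2 this
  filter_upwards [hne] with r hrb hr
  rw [Set.uIoc_of_le hab] at hr
  have hrb' : r < b := lt_of_le_of_ne hr.2 hrb
  have hflight : γ r = freeFlight (Torus.geometry (Fin 3)) (r - a) (γ a) :=
    hγ.free a r hr.1.le fun τ hτ => hfree τ ⟨hτ.1, lt_of_le_of_lt hτ.2 hrb'⟩
  rw [hflight, obsK_freeFlight]

/-- **Free piece → 0.** If moreover no particle has vanishing first velocity component at time `a`, the piece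
tends to `0` as `k → ∞` (free-streaming dephasing). [folklore] -/
theorem tendsto_integral_piece {ε : ℝ} {γ : ℝ → Config n (Fin 3) T3}
    (hγ : IsHardSphereTrajectory (Torus.geometry (Fin 3)) ε n γ) {a b : ℝ} (hab : a ≤ b)
    (hfree : ∀ τ ∈ Ioo a b, τ ∉ collisionTimes (Torus.geometry (Fin 3)) ε γ)
    (hv : ∀ i, (γ a i).2 0 ≠ 0) (g : V3 → ℝ) :
    Tendsto (fun k : ℕ => ∫ r in a..b, obsK k g (γ r)) atTop (𝓝 0) := by
  have heq : ∀ k : ℕ, ∫ r in a..b, obsK k g (γ r) =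
      ∑ i, (∫ r in a..b, Real.cos (2 * Real.pi * k * (Torus.reprSym (γ a i).1 0 + (r - a) * (γ a i).2 0))) *
        g (γ a i).2 := by
    intro k
    rw [integral_piece_eq hγ hab hfree k g, intervalIntegral.integral_finsetSum]
    · simp_rw [intervalIntegral.integral_mul_const]
    · intro i _
      exact (Continuous.intervalIntegrable (by fun_prop) _ _)
  simp_rw [heq]
  rw [show (0 : ℝ) = ∑ i : Fin n, 0 * g (γ a i).2 by simp]
  refine tendsto_finsetSum _ fun i _ => ?_
  exact (tendsto_integral_cos_flight (a := a) (b := b) (hv i) (fun _ => Torus.reprSym (γ a i).1 0)).mul_const _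

/-- **All pieces → 0** (induction on the number of collisions strictly inside the stretch, which is finite on a
hard-sphere trajectory): the window integral of the modulated observable over `[a, b]` tends to `0` as `k → ∞`,
provided no particle ever has vanishing first velocity component. [folklore] -/
theorem tendsto_integral_obsK {ε : ℝ} {γ : ℝ → Config n (Fin 3) T3}
    (hγ : IsHardSphereTrajectory (Torus.geometry (Fin 3)) ε n γ) (hγm : Measurable γ)
    (hv : ∀ r i, (γ r i).2 0 ≠ 0) {g : V3 → ℝ} (hg : Continuous g) {K : ℝ} (hgb : ∀ v, |g v| ≤ K) :
    ∀ (m : ℕ) {a b : ℝ}, a ≤ b → (collisionTimes (Torus.geometry (Fin 3)) ε γ ∩ Ioo a b).ncard ≤ m →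
      Tendsto (fun k : ℕ => ∫ r in a..b, obsK k g (γ r)) atTop (𝓝 0) := by
  set C := collisionTimes (Torus.geometry (Fin 3)) ε γ with hC
  have hfin : ∀ a b : ℝ, (C ∩ Ioo a b).Finite := fun a b =>
    (hγ.locFinite a b).subset (Set.inter_subset_inter_right _ Ioo_subset_Icc_self)
  have hii : ∀ (k : ℕ) (a b : ℝ), IntervalIntegrable (fun r => obsK k g (γ r)) volume a b := fun k a b =>
    intervalIntegrable_of_bounded ((continuous_obsK k hg).measurable.comp hγm) (fun r => abs_obsK_le k hgb _) a b
  -- the empty case, used twice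
  have hbase : ∀ {a b : ℝ}, a ≤ b → C ∩ Ioo a b = ∅ →
      Tendsto (fun k : ℕ => ∫ r in a..b, obsK k g (γ r)) atTop (𝓝 0) := by
    intro a b hab hempty
    refine tendsto_integral_piece hγ hab (fun τ hτ hτC => ?_) (fun i => hv a i) g
    have : τ ∈ C ∩ Ioo a b := ⟨hτC, hτ⟩
    rw [hempty] at this
    exact this
  intro m
  induction m with
  | zero =>
    intro a b hab hcard
    exact hbase hab ((Set.ncard_eq_zero (hfin a b)).1 (Nat.le_zero.1 hcard))
  | succ m ih =>
    intro a b hab hcard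
    by_cases hem : (C ∩ Ioo a b).Nonempty
    · have hne : (hfin a b).toFinset.Nonempty := by simpa using hem
      set c := (hfin a b).toFinset.max' hne with hcdef
      have hc : c ∈ C ∩ Ioo a b := by
        have := (hfin a b).toFinset.max'_mem hne
        rwa [Set.Finite.mem_toFinset] at this
      have hcmax : ∀ τ ∈ C ∩ Ioo a b, τ ≤ c := fun τ hτ =>
        (hfin a b).toFinset.le_max' τ ((Set.Finite.mem_toFinset _).2 hτ)
      -- right piece: no collision in `(c, b)`
      have hR : Tendsto (fun k : ℕ => ∫ r in c..b, obsK k g (γ r)) atTop (𝓝 0) := by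
        refine tendsto_integral_piece hγ hc.2.2.le (fun τ hτ hτC => ?_) (fun i => hv c i) g
        have := hcmax τ ⟨hτC, hc.2.1.trans hτ.1, hτ.2⟩
        linarith [hτ.1]
      -- left piece: one collision fewer strictly inside `(a, c)`
      have hL : Tendsto (fun k : ℕ => ∫ r in a..c, obsK k g (γ r)) atTop (𝓝 0) := by
        refine ih hc.2.1.le ?_
        have hss : C ∩ Ioo a c ⊂ C ∩ Ioo a b := by
          refine ⟨fun τ hτ => ⟨hτ.1, hτ.2.1, hτ.2.2.trans hc.2.2⟩, fun hsub => ?_⟩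
          have := (hsub hc).2.2
          linarith
        have := Set.ncard_lt_ncard hss (hfin a b)
        omega
      have hsum : ∀ k : ℕ, ∫ r in a..b, obsK k g (γ r) =
          (∫ r in a..c, obsK k g (γ r)) + ∫ r in c..b, obsK k g (γ r) := fun k =>
        (intervalIntegral.integral_add_adjacent_intervals (hii k a c) (hii k c b)).symm
      simp_rw [hsum]
      simpa using hL.add hR
    · exact hbase hab (Set.not_nonempty_iff_eq_empty.1 hem)

end BoltzmannGreenKuboUniformPhi

end Summit.AtomisticToContinuum.HydrodynamicLimit.Theorems

end
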